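import Summits.HodgeConjecture.CorCM.MumfordTateRankSevenSimpleCenter
import Summits.HodgeConjecture.CorCM.MumfordTateRankFour
import Summits.HodgeConjecture.CorCM.EndAlgebraCenterAlgebra
import Summits.HodgeConjecture.CorCM.EndAlgebraMatrixProduct
import Summits.HodgeConjecture.CorCM.FieldOfDegreeTwoDimOnPowers
import Literature.AlgebraicGeometry.Motives.ComplexTorusSimpleTransfer
import Literature.AlgebraicGeometry.Motives.AbelianVarietyEndAlgebraInstances
import HarnessLib

/-!
# The rung `dim MT(H¹(X)) = 7` with `ℚ`-SIMPLE Hodge Lie algebra, II: in the `Res_{K/ℚ} SL₂` position `X ∼ B^{m+1}`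
# with `B` an abelian SURFACE with REAL MULTIPLICATION by `K` or a FOURFOLD with quaternion multiplication over `K`

COR-CM (cell `pub-hodgecm2`, seat `b27` gen 40, count-neutral lane MT-RANK-SEVEN-SIMPLE; theorems only, no definition, no
named fact; UNCONDITIONAL — nothing here uses or asserts HC_CM).  Sequel of `CorCM/MumfordTateRankSevenSimpleCenter`: there,
for `0 < dim X`, `𝔷 = 0`, `dim MT(H¹X) = 7`, `Lie Hg(H¹X)` `ℚ`-simple and `dim 𝔤⁺ = 2`, the centre `K = Z(End⁰X)` is a real
quadratic field and `dim End⁰X = k₁² + k₂²`, `dim X = k₁ + k₂` (`kᵢ ≥ 1`).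

* **`exists_isIsogenous_power_of_isSimple_of_finrank_gradingPlus_eq_two`** — `X ∼ B^{m+1}` is ISOTYPIC (`Z(End⁰X)` is a
  field: along `X ∼ ⨁ᵢ Bᵢ^{nᵢ+1}` the centre is `∏ᵢ Z(End⁰Bᵢ)`, `CorCM/EndAlgebraCenterAlgebra`, and two factors would give
  zero-divisors), `B` simple with `Z(End⁰B) ≅ K` real quadratic (`φ² = q`, `0 < q ∈ ℚ` not a square), and BY ARITHMETIC ALONE
  (`dim End⁰X = (m+1)² dim End⁰B = k₁² + k₂²`, `dim X = (m+1) dim B = k₁ + k₂`, `2 = [K:ℚ] ∣ dim End⁰B ∣ 2 dim B`,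
  `(k₁+k₂)² > k₁² + k₂² ≥ (k₁+k₂)²/2`; the case `dim B = 3` would need `3(m+1)²` to be a square): EITHER
  **`dim B = 2` and `End⁰B = K`** (an abelian surface with REAL MULTIPLICATION by the real quadratic field `K`; `End⁰B` is a
  field) OR **`dim B = 4` and `dim_ℚ End⁰B = 8`** (a quaternion algebra over `K`: type II in Albert's list — Albert's
  classification is not used).  Moonen–Zarhin (2.3): these are exactly the `Hg = Res_{K/ℚ} SL₂`-shapes.

## References

* [MoonenZarhin1999LowDim] B. Moonen, Yu. Zarhin, *Hodge classes on abelian varieties of low dimension*, Math. Ann.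
  315 (1999), §2 and (2.3) (types I(2), II(2)).
* [MumfordAV1970] D. Mumford, *Abelian Varieties* (1970), §19 Cor. 1–2 of Thm. 1 (pp. 173–174), §21.
* [SwinnertonDyer1974] H. P. F. Swinnerton-Dyer, *Analytic theory of abelian varieties* (1974), §10 Lemma 44.
-/

noncomputable section

open scoped TensorProduct
open CategoryTheory CategoryTheory.Limits Module

namespace Summit.HodgeConjecture.CorCM

open Literature.AlgebraicGeometry.Motives
open Literature.AlgebraicGeometry.Motives.AbelianVariety
open Literature.AlgebraicGeometry.Motives.HodgeStructure
open Literature.AlgebraicGeometry.HodgeTheory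

variable [HodgeTensorFacts.{0, 0}] {X : AbelianVariety ℂ} {n : ℕ}

omit [HodgeTensorFacts.{0, 0}] in
/-- `3 j²` is not a square for `j ≠ 0` (the `3`-adic valuation of a square is even). [cite: MumfordAV1970, §21] -/
private theorem not_sq_eq_three_mul_sq {d j : ℕ} (hj : j ≠ 0) (h : d * d = 3 * (j * j)) : False := by
  have hd : d ≠ 0 := by
    rintro rfl
    simp only [zero_mul, zero_eq_mul, OfNat.ofNat_ne_zero, false_or, mul_self_eq_zero] at h
    exact hj h
  haveI : Fact (Nat.Prime 3) := ⟨Nat.prime_three⟩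
  have hv := congrArg (padicValNat 3) h
  rw [padicValNat.mul hd hd, padicValNat.mul (by norm_num) (mul_ne_zero hj hj), padicValNat.mul hj hj,
    padicValNat.self (by norm_num)] at hv
  omega

/-- **`X ∼ B^{m+1}` with `B` an abelian surface with real multiplication by the real quadratic field `K = Z(End⁰X)`, or a
fourfold with an `8`-dimensional endomorphism algebra with centre `K`** — for `0 < dim X`, `𝔷 = 0`, `dim MT(H¹X) = 7`,
`Lie Hg(H¹X)` `ℚ`-simple and `dim 𝔤⁺ = 2` (the `Res_{K/ℚ} SL₂` position).  Also recorded: `X.dim = (m+1)·dim B = k₁ + k₂`,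
`dim End⁰X = (m+1)² dim End⁰B = k₁² + k₂²` with EQUAL multiplicities `k₁ = k₂` of the two complex factors (by arithmetic),
`dim_ℚ Z(End⁰B) = 2`, `Z(End⁰B) = ℚ ⊕ ℚφ`, `φ² = q`, `0 < q` not a square.
[cite: MoonenZarhin1999LowDim, §2 and (2.3)] [cite: MumfordAV1970, §19 Cor. 1–2 of Thm. 1 (pp. 173–174)]
[cite: SwinnertonDyer1974, §10 Lemma 44] -/
theorem exists_isIsogenous_power_of_isSimple_of_finrank_gradingPlus_eq_two (hX : IsSmoothProjective n X.X)
    (h0 : 0 < X.dim)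
    (hz : haveI := BettiUniverse.finite hX 1
      (BettiUniverse.hodge exists_isReal_hodgeModel_holds hX 1).hodgeLie ⊓
        Subalgebra.toSubmodule (BettiUniverse.hodge exists_isReal_hodgeModel_holds hX 1).endAlg = ⊥)
    (h7 : haveI := BettiUniverse.finite hX 1
      (BettiUniverse.hodge exists_isReal_hodgeModel_holds hX 1).mtRank = 7)
    (hsimple : haveI := BettiUniverse.finite hX 1
      letI : LieRing (Module.End ℚ (bettiCohomology X.X 1)) := LieRing.ofAssociativeRing
      ∀ 𝔏 : LieSubalgebra ℚ (Module.End ℚ (bettiCohomology X.X 1)),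
        𝔏.toSubmodule = (BettiUniverse.hodge exists_isReal_hodgeModel_holds hX 1).hodgeLie → LieAlgebra.IsSimple ℚ 𝔏)
    {S : Type} [Fintype S] [DecidableEq S] {deg : S → ℤ} (e : Module.Basis S ℂ (ℂ ⊗[ℚ] bettiCohomology X.X 1))
    (hF : ∀ a, (BettiUniverse.hodge exists_isReal_hodgeModel_holds hX 1).F a = Submodule.span ℂ (e '' {σ | a ≤ deg σ}))
    (hFc : ∀ a, complexConj ((BettiUniverse.hodge exists_isReal_hodgeModel_holds hX 1).F a) =
      Submodule.span ℂ (e '' {σ | deg σ ≤ ((1 : ℕ) : ℤ) - a}))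
    (hp2 : haveI := BettiUniverse.finite hX 1
      Module.finrank ℂ ((BettiUniverse.hodge exists_isReal_hodgeModel_holds hX 1).hodgeLieC ⊓ Module.End.eigenspace
        (LinearMap.mulLeft ℂ (gradingEnd e deg) - LinearMap.mulRight ℂ (gradingEnd e deg)) 1 : Submodule ℂ _) = 2) :
    ∃ (B : AbelianVariety ℂ) (m k₁ k₂ : ℕ) (φ : B.endAlgebra) (q : ℚ),
      B.IsSimple ∧ 0 < B.dim ∧ IsIsogenous X (⨁ fun _ : Fin (m + 1) => B) ∧ X.dim = (m + 1) * B.dim ∧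
      0 < k₁ ∧ 0 < k₂ ∧ k₁ = k₂ ∧ X.dim = k₁ + k₂ ∧ Module.finrank ℚ X.endAlgebra = k₁ ^ 2 + k₂ ^ 2 ∧
      Module.finrank ℚ X.endAlgebra = (m + 1) ^ 2 * Module.finrank ℚ B.endAlgebra ∧
      Module.finrank ℚ (Subalgebra.center ℚ B.endAlgebra) = 2 ∧
      φ ∈ Subalgebra.center ℚ B.endAlgebra ∧ 0 < q ∧ ¬ IsSquare q ∧ φ * φ = algebraMap ℚ B.endAlgebra q ∧
      (∀ z ∈ Subalgebra.center ℚ B.endAlgebra, ∃ a b : ℚ, z = algebraMap ℚ B.endAlgebra a + b • φ) ∧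
      ((B.dim = 2 ∧ Module.finrank ℚ B.endAlgebra = 2 ∧ (∀ x y : B.endAlgebra, x * y = y * x) ∧ IsField B.endAlgebra) ∨
        (B.dim = 4 ∧ Module.finrank ℚ B.endAlgebra = 8)) := by
  classical
  obtain ⟨k₁, k₂, φX, q, hk₁, hk₂, hdimX, hdimE, hZ2, hφXc, hq, hnsq, hφXsq, hspanX, hnzd⟩ :=
    center_endAlgebra_of_isSimple_of_finrank_gradingPlus_eq_two hX h0 hz h7 hsimple e hF hFc hp2
  -- the isotypic decomposition and the centre as a product of fields
  obtain ⟨r, B, nB, hS, hd, hni, hXB, ⟨eZ⟩, hZF⟩ := CMProductEnd.exists_center_endAlgebra_algEquiv_pi X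
  -- exactly one isotypic component: no zero-divisors in `Z(End⁰X)`
  have hr : r = 1 := by
    rcases r with _ | _ | r
    · exfalso
      haveI : Subsingleton (∀ i : Fin 0, Subalgebra.center ℚ (B i).endAlgebra) := inferInstance
      haveI : Subsingleton (Subalgebra.center ℚ X.endAlgebra) := eZ.toEquiv.subsingleton
      rw [Module.finrank_zero_of_subsingleton] at hZ2
      exact absurd hZ2 (by norm_num)
    · rfl
    · exfalso
      haveI : ∀ i, Nontrivial (Subalgebra.center ℚ (B i).endAlgebra) := fun i =>
        (letI := (hZF i).toField; inferInstance)
      set u : ∀ i : Fin (r + 2), Subalgebra.center ℚ (B i).endAlgebra := Pi.single 0 1 with hu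
      set v : ∀ i : Fin (r + 2), Subalgebra.center ℚ (B i).endAlgebra := Pi.single 1 1 with hv
      have h01 : (0 : Fin (r + 2)) ≠ 1 := Fin.ne_of_val_ne (by simp)
      have huv : u * v = 0 := by
        funext i
        rw [Pi.mul_apply, Pi.zero_apply, hu, hv]
        by_cases hi : i = 0
        · rw [hi, Pi.single_eq_of_ne h01, mul_zero]
        · rw [Pi.single_eq_of_ne hi, zero_mul]
      have hu0 : u ≠ 0 := fun h => by
        have h' := congr_fun h 0
        rw [hu, Pi.single_eq_same, Pi.zero_apply] at h'
        exact one_ne_zero h'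
      have hv0 : v ≠ 0 := fun h => by
        have h' := congr_fun h 1
        rw [hv, Pi.single_eq_same, Pi.zero_apply] at h'
        exact one_ne_zero h'
      have h0 : eZ.symm u * eZ.symm v = 0 := by rw [← map_mul, huv, map_zero]
      have h := hnzd (eZ.symm u) (eZ.symm u).2 (eZ.symm v) (eZ.symm v).2 (congrArg Subtype.val h0)
      rcases h with h | h
      · exact hu0 (eZ.symm.injective (Subtype.ext (by rw [h, map_zero]; rfl)))
      · exact hv0 (eZ.symm.injective (Subtype.ext (by rw [h, map_zero]; rfl)))
  subst hr
  -- `X ∼ (B 0)^{m+1}`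
  set m := nB 0 with hm
  let ι0 : (⨁ fun i : Fin 1 => ⨁ fun _ : Fin (nB i + 1) => B i) ≅ ⨁ fun _ : Fin (nB 0 + 1) => B 0 :=
    biproductUniqueIso (fun i : Fin 1 => ⨁ fun _ : Fin (nB i + 1) => B i)
  have hX0 : IsIsogenous X (⨁ fun _ : Fin (m + 1) => B 0) := hXB.trans ⟨ι0.hom, isIsogeny_hom_of_iso ι0⟩
  obtain ⟨e0⟩ := hX0.nonempty_endAlgebra_algEquiv
  have hdimXB : X.dim = (m + 1) * (B 0).dim := by
    obtain ⟨f, hf⟩ := hX0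
    rw [dim_eq_of_isIsogeny hf, AndreRiemann.dim_biproduct_const]
  have hEXB : Module.finrank ℚ X.endAlgebra = (m + 1) ^ 2 * Module.finrank ℚ (B 0).endAlgebra := by
    rw [hX0.finrank_endAlgebra_eq, EndAlgebraPower.finrank_endAlgebra_biproduct]
  -- `Z(End⁰ B) ≃ₐ Z(End⁰ X)`
  obtain ⟨e1, -⟩ := CMProductEnd.nonempty_algEquiv_center_of_algEquiv e0
  obtain ⟨e2, -⟩ := CMProductEnd.nonempty_algEquiv_center_endAlgebra_biproduct (B := B 0) (m := m + 1) (Nat.succ_pos m)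
  let eB : Subalgebra.center ℚ X.endAlgebra ≃ₐ[ℚ] Subalgebra.center ℚ (B 0).endAlgebra := e1.trans e2.symm
  have hZB : Module.finrank ℚ (Subalgebra.center ℚ (B 0).endAlgebra) = 2 := by
    rw [← eB.toLinearEquiv.finrank_eq]; exact hZ2
  -- transport `φ`
  set φB : (B 0).endAlgebra := ((eB ⟨φX, hφXc⟩ : Subalgebra.center ℚ (B 0).endAlgebra) : (B 0).endAlgebra) with hφB
  have hφBc : φB ∈ Subalgebra.center ℚ (B 0).endAlgebra := (eB ⟨φX, hφXc⟩).2
  have hφBsq : φB * φB = algebraMap ℚ (B 0).endAlgebra q := by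
    have h : (⟨φX, hφXc⟩ : Subalgebra.center ℚ X.endAlgebra) * ⟨φX, hφXc⟩ = algebraMap ℚ _ q :=
      Subtype.ext (by rw [Subalgebra.coe_mul, Subalgebra.coe_algebraMap]; exact hφXsq)
    have h' := congrArg (fun z => ((eB z : Subalgebra.center ℚ (B 0).endAlgebra) : (B 0).endAlgebra)) h
    simp only [map_mul, Subalgebra.coe_mul, AlgEquiv.commutes, Subalgebra.coe_algebraMap] at h'
    rw [hφB]; exact h'
  have hspanB : ∀ z ∈ Subalgebra.center ℚ (B 0).endAlgebra, ∃ a b : ℚ, z = algebraMap ℚ (B 0).endAlgebra a + b • φB := by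
    intro z hz
    obtain ⟨a, b, hab⟩ := hspanX _ (eB.symm ⟨z, hz⟩).2
    refine ⟨a, b, ?_⟩
    have h : (⟨z, hz⟩ : Subalgebra.center ℚ (B 0).endAlgebra) = eB (eB.symm ⟨z, hz⟩) := (eB.apply_symm_apply _).symm
    have h2 : (eB.symm ⟨z, hz⟩ : Subalgebra.center ℚ X.endAlgebra) = algebraMap ℚ _ a + b • ⟨φX, hφXc⟩ :=
      Subtype.ext (by rw [Subalgebra.coe_add, Subalgebra.coe_algebraMap, Subalgebra.coe_smul]; exact hab)
    have h3 := congrArg (fun w => ((eB w : Subalgebra.center ℚ (B 0).endAlgebra) : (B 0).endAlgebra)) h2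
    simp only [map_add, map_smul, AlgEquiv.commutes, Subalgebra.coe_add, Subalgebra.coe_smul,
      Subalgebra.coe_algebraMap] at h3
    rw [← hφB] at h3
    rw [← h3]
    exact congrArg Subtype.val h
  -- arithmetic: `g = dim B`, `mB = dim_ℚ End⁰B`
  obtain ⟨g, hg⟩ : ∃ g, (B 0).dim = g := ⟨_, rfl⟩
  obtain ⟨mB, hmB⟩ : ∃ mB, Module.finrank ℚ (B 0).endAlgebra = mB := ⟨_, rfl⟩
  have h2mB : 2 ∣ mB := by
    rw [← hmB, ← hZB]; exact CMProductEnd.finrank_center_dvd_finrank_endAlgebra (hS 0) (hd 0)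
  have hmB2g : mB ∣ 2 * g := by
    rw [← hmB, ← hg]
    exact Literature.AlgebraicGeometry.ComplexMultiplication.finrank_endAlgebra_dvd_two_mul_dim (hS 0)
  have hg0 : 0 < g := hg ▸ hd 0
  have hA : (m + 1) ^ 2 * mB = k₁ ^ 2 + k₂ ^ 2 := by rw [← hmB, ← hEXB, hdimE]
  have hBsum : (m + 1) * g = k₁ + k₂ := by rw [← hg, ← hdimXB, hdimX]
  -- `mB < g²` and `g² ≤ 2 mB`
  have hk1 : k₁ ^ 2 + k₂ ^ 2 < (k₁ + k₂) ^ 2 := by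
    have h := Nat.mul_pos hk₁ hk₂
    have h' : (k₁ + k₂) ^ 2 = k₁ ^ 2 + k₂ ^ 2 + 2 * (k₁ * k₂) := by ring
    omega
  have hk2 : (k₁ + k₂) ^ 2 ≤ 2 * (k₁ ^ 2 + k₂ ^ 2) := by
    have h : ((k₁ : ℤ) + k₂) ^ 2 ≤ 2 * ((k₁ : ℤ) ^ 2 + (k₂ : ℤ) ^ 2) := by nlinarith [sq_nonneg ((k₁ : ℤ) - k₂)]
    exact_mod_cast h
  have hlt : mB < g * g := by
    have h : (m + 1) ^ 2 * mB < (m + 1) ^ 2 * (g * g) := by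
      rw [hA, ← sq, ← mul_pow, hBsum]; exact hk1
    exact Nat.lt_of_mul_lt_mul_left h
  have hle : g * g ≤ 2 * mB := by
    have h : (m + 1) ^ 2 * (g * g) ≤ (m + 1) ^ 2 * (2 * mB) := by
      rw [← sq, ← mul_pow, hBsum, mul_left_comm, hA]; exact hk2
    exact Nat.le_of_mul_le_mul_left h (by positivity)
  have hmBle : mB ≤ 2 * g := Nat.le_of_dvd (by omega) hmB2g
  have hg4 : g ≤ 4 := by nlinarith
  obtain ⟨c, hc⟩ := h2mB
  -- the case analysis `g ∈ {1, 2, 3, 4}`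
  have hcases : (g = 2 ∧ mB = 2) ∨ (g = 4 ∧ mB = 8) := by
    interval_cases g
    · omega
    · left; exact ⟨rfl, by omega⟩
    · -- `g = 3`: `mB = 6`, then `(k₁ - k₂)² = 3 (m+1)²`
      exfalso
      have hmB6 : mB = 6 := by omega
      subst hmB6
      have h1 : ((m : ℤ) + 1) ^ 2 * 6 = (k₁ : ℤ) ^ 2 + (k₂ : ℤ) ^ 2 := by exact_mod_cast hA
      have h2 : ((m : ℤ) + 1) * 3 = (k₁ : ℤ) + k₂ := by exact_mod_cast hBsum
      have hsq : ((k₁ : ℤ) - k₂) * ((k₁ : ℤ) - k₂) = ((3 * ((m + 1) * (m + 1)) : ℕ) : ℤ) := by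
        push_cast
        linear_combination (-2 : ℤ) * h1 + (3 * ((m : ℤ) + 1) + (k₁ + k₂)) * h2
      have h := congrArg Int.natAbs hsq
      rw [Int.natAbs_mul, Int.natAbs_natCast] at h
      exact not_sq_eq_three_mul_sq (Nat.succ_ne_zero m) h
    · right; exact ⟨rfl, by omega⟩
  -- equal multiplicities of the two complex factors: `(k₁ - k₂)² = 2 (k₁² + k₂²) - (k₁ + k₂)² = 0` in both cases
  have hk : k₁ = k₂ := by
    have hsq : ((k₁ : ℤ) - k₂) ^ 2 = 0 := by
      rcases hcases with ⟨hg2, hmB2⟩ | ⟨hg4', hmB8⟩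
      · subst hg2 hmB2
        have h1 : ((m : ℤ) + 1) ^ 2 * 2 = (k₁ : ℤ) ^ 2 + (k₂ : ℤ) ^ 2 := by exact_mod_cast hA
        have h2 : ((m : ℤ) + 1) * 2 = (k₁ : ℤ) + k₂ := by exact_mod_cast hBsum
        linear_combination (-2 : ℤ) * h1 + (2 * ((m : ℤ) + 1) + (k₁ + k₂)) * h2
      · subst hg4' hmB8
        have h1 : ((m : ℤ) + 1) ^ 2 * 8 = (k₁ : ℤ) ^ 2 + (k₂ : ℤ) ^ 2 := by exact_mod_cast hA
        have h2 : ((m : ℤ) + 1) * 4 = (k₁ : ℤ) + k₂ := by exact_mod_cast hBsum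
        linear_combination (-2 : ℤ) * h1 + (4 * ((m : ℤ) + 1) + (k₁ + k₂)) * h2
    have h := (pow_eq_zero_iff (two_ne_zero)).1 hsq
    omega
  refine ⟨B 0, m, k₁, k₂, φB, q, hS 0, hd 0, hX0, hdimXB, hk₁, hk₂, hk, hdimX, hdimE, hEXB, hZB, hφBc, hq, hnsq, hφBsq,
    hspanB, ?_⟩
  rcases hcases with ⟨hg2, hmB2⟩ | ⟨hg4', hmB8⟩
  · left
    subst hg2 hmB2
    -- `End⁰(B) = Z(End⁰ B)` is commutative, a field
    haveI : FiniteDimensional ℚ (⊤ : Subalgebra ℚ (B 0).endAlgebra) :=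
      Module.Finite.equiv (Subalgebra.topEquiv (R := ℚ) (A := (B 0).endAlgebra)).symm.toLinearEquiv
    have htop : Subalgebra.center ℚ (B 0).endAlgebra = ⊤ :=
      Subalgebra.eq_of_le_of_finrank_eq le_top (by rw [hZB, Subalgebra.topEquiv.toLinearEquiv.finrank_eq, hmB])
    have hcomm : ∀ x y : (B 0).endAlgebra, x * y = y * x := fun x y => by
      have hx : x ∈ Subalgebra.center ℚ (B 0).endAlgebra := by rw [htop]; exact Algebra.mem_top
      exact ((Subalgebra.mem_center_iff.1 hx) y).symm
    have hfield : IsField (B 0).endAlgebra := by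
      haveI : Nontrivial (B 0).endAlgebra := FieldOnPowers.nontrivial_endAlgebra_of_dim_pos (hd 0)
      refine ⟨exists_pair_ne _, hcomm, fun {a} ha => ?_⟩
      rcases IsSimple.isUnit_or_eq_zero (hS 0) a with hu | h
      · obtain ⟨u, rfl⟩ := hu
        exact ⟨↑u⁻¹, u.mul_inv⟩
      · exact absurd h ha
    exact ⟨hg, hmB, hcomm, hfield⟩
  · right; subst hg4' hmB8; exact ⟨hg, hmB⟩

end Summit.HodgeConjecture.CorCM

end
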